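import Summits.ValiantsHypothesis.ValiantsHypothesis.Theorems.LacunarySymmetroidMatrixDescartesDoorA26WallBubblingTowers

/-!
# Wall bubbling for `DoorA26` — (W) chain piece at a Weyl TRIPLE: THE CLASS ASSEMBLY (all value classes, all derivatives, continuous convergence)

HONEST FRAMING.  Chain lemma toward `TripleStratum26` of `Cruxes/DoorA26/Lines/wall_bubbling_ConfluentDoor.lean` (rev 13; crux `DoorA26`,
stmt-ValiantsHypothesis-19979 — OPEN, typed, never asserted).  W1 seat val-sym-door-p2 g15 (#83); the «assembly over the value classes with the
factors `e^{E_V t}·C(j,r)E_V^{j−r}` and the identification of the limit tower with `iteratedDeriv j F`» that W2's `…ClassTower` docstring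
(door-p1 g13) left to a successor — needed NOW because at a Weyl triple the cluster limit is taken class by class in moment currency
(#81 `…MomentTail`, #82 `…MomentTower`) instead of through a Gram-normalised frame.  Generic in the index types (members `ι`, classes `κ`,
`cls : ι → κ`); exponents `x_i^ν = w^ν_{cls i} + ε_i^ν`, class centres `w^ν_k → w_k`, scale `μ_ν`:

* `hasDerivAt_taylorPoly`, `iteratedDeriv_taylorPoly`, `contDiff_taylorPoly` — the truncated Taylor polynomials
  `Q_r(s) = Σ_{m<n−r} c_{r+m} s^m/m!` form a derivative tower (`Q_r' = Q_{r+1}`), so `iteratedDeriv r Q_0 = Q_r`;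
* `sum_eq_sum_classes` — regrouping a member sum by classes;
* `iteratedDeriv_normalisedSum_eq_classes` — LEVEL-ν IDENTITY: the `j`-th derivative of `s ↦ μ⁻¹Σ_i a_i e^{x_i s}` is
  `Σ_k e^{w_k s} Σ_{r≤j} C(j,r) w_k^{j−r} · μ⁻¹Σ_{cls i = k} a_i ε_i^r e^{ε_i s}` (W2's `iteratedDeriv_expSum` + `expSum_classWeights` per class);
* `iteratedDeriv_classLimitFun` — LIMIT IDENTITY: the `j`-th derivative of `g(s) = Σ_k Q_{k,0}(s) e^{w_k s}` is `Σ_k e^{w_k s}Σ_{r≤j} C(j,r) w_k^{j−r} Q_{k,r}(s)`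
  (Leibniz `iteratedDeriv_mul` + the tower);
* **`classLimit_iteratedDeriv`** — if every `ε^r`-weighted class function converges continuously on windows to `Q_{k,r}` (the conclusion of
  `momentTower_limit` / `classTower_limit`, class by class) then EVERY `iteratedDeriv` of the normalised sum converges continuously on windows to
  that of `g` — literally the `hconv` input of W2's `multiplicity_transfer_iteratedDeriv`, with `g` in the `Σ_w P_w(t)e^{wt}` shape of W1 #12
  `extSum_zerosWithMultiplicity_le`.

No definitions; nothing here bears on `DoorA26`, `MatrixDescartes` (stmt-ValiantsHypothesis-18050) or `VP ≠ VNP`; `TripleStratum26`, (W), (M) OPEN.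

[folklore] Leibniz' rule; binomial regrouping; elementary limits.  [this work] the bookkeeping.
-/

-- `Summit.ValiantsHypothesis.ValiantsHypothesis.…` repeats a component by the D-0017 layout
-- (single-conjunct summit), which the `dupNamespace` linter flags; the name is mandated.
set_option linter.dupNamespace false

namespace Summit.ValiantsHypothesis.ValiantsHypothesis.Theorems.LacunarySymmetroidMatrixDescartes.WallBubbling

open Finset Filter Topology
open scoped BigOperators

/-! ## 1. The truncated Taylor tower -/

/-- `Q_r' = Q_{r+1}` for `Q_r(s) = Σ_{m<n−r} c_{r+m} s^m/m!`. [folklore] -/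
theorem hasDerivAt_taylorPoly (c : ℕ → ℝ) (n r : ℕ) (s : ℝ) :
    HasDerivAt (fun s => ∑ m ∈ Finset.range (n - r), c (r + m) * s ^ m / (m.factorial : ℝ))
      (∑ m ∈ Finset.range (n - (r + 1)), c (r + 1 + m) * s ^ m / (m.factorial : ℝ)) s := by
  have h1 : HasDerivAt (fun s => ∑ m ∈ Finset.range (n - r), c (r + m) * s ^ m / (m.factorial : ℝ))
      (∑ m ∈ Finset.range (n - r), c (r + m) * ((m : ℝ) * s ^ (m - 1)) / (m.factorial : ℝ)) s := by
    have h := HasDerivAt.fun_sum (u := Finset.range (n - r))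
      (A := fun m x => c (r + m) * x ^ m / (m.factorial : ℝ))
      (A' := fun m => c (r + m) * ((m : ℝ) * s ^ (m - 1)) / (m.factorial : ℝ)) (x := s)
      (fun m _ => ((hasDerivAt_pow m s).const_mul (c (r + m))).div_const (m.factorial : ℝ))
    exact h
  have h2 : ∑ m ∈ Finset.range (n - r), c (r + m) * ((m : ℝ) * s ^ (m - 1)) / (m.factorial : ℝ)
      = ∑ m ∈ Finset.range (n - (r + 1)), c (r + 1 + m) * s ^ m / (m.factorial : ℝ) := by
    rcases Nat.eq_zero_or_pos (n - r) with h0 | hpos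
    · have h0' : n - (r + 1) = 0 := by omega
      rw [h0, h0']
      simp
    · obtain ⟨M, hM⟩ : ∃ M, n - r = M + 1 := ⟨n - r - 1, by omega⟩
      have hM' : n - (r + 1) = M := by omega
      rw [hM, hM', Finset.sum_range_succ']
      simp only [Nat.cast_zero, zero_mul, mul_zero, zero_div, add_zero]
      refine Finset.sum_congr rfl fun m _ => ?_
      rw [Nat.factorial_succ, Nat.cast_mul, Nat.cast_succ, Nat.add_sub_cancel, show r + (m + 1) = r + 1 + m by ring]
      have hm : (m.factorial : ℝ) ≠ 0 := by positivity
      have hm1 : ((m : ℝ) + 1) ≠ 0 := by positivity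
      field_simp
  rw [h2] at h1
  exact h1

/-- `iteratedDeriv r Q_0 = Q_r`. [folklore] -/
theorem iteratedDeriv_taylorPoly (c : ℕ → ℝ) (n r : ℕ) :
    iteratedDeriv r (fun s => ∑ m ∈ Finset.range (n - 0), c (0 + m) * s ^ m / (m.factorial : ℝ))
      = fun s => ∑ m ∈ Finset.range (n - r), c (r + m) * s ^ m / (m.factorial : ℝ) :=
  iteratedDeriv_eq_of_tower (fun r s => ∑ m ∈ Finset.range (n - r), c (r + m) * s ^ m / (m.factorial : ℝ))
    (fun r s => hasDerivAt_taylorPoly c n r s) r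

/-- The truncated Taylor polynomials are smooth. [folklore] -/
theorem contDiff_taylorPoly (c : ℕ → ℝ) (n r : ℕ) (N : ℕ) :
    ContDiff ℝ N (fun s : ℝ => ∑ m ∈ Finset.range (n - r), c (r + m) * s ^ m / (m.factorial : ℝ)) :=
  ContDiff.sum fun m _ => (contDiff_const.mul (contDiff_id.pow m)).div_const _

/-! ## 2. Regrouping by classes and the level-ν identity -/

/-- Regrouping a member sum by classes. [folklore] -/
theorem sum_eq_sum_classes {ι κ : Type*} [Fintype ι] [Fintype κ] [DecidableEq κ] (cls : ι → κ) (f : ι → ℝ) :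
    ∑ i, f i = ∑ k, ∑ i, (if cls i = k then f i else 0) := by
  rw [Finset.sum_comm]
  refine Finset.sum_congr rfl fun i _ => ?_
  rw [Finset.sum_ite_eq]
  simp

/-- **LEVEL-ν IDENTITY.**  The `j`-th derivative of the normalised member sum, regrouped by classes with binomial weights. [folklore] -/
theorem iteratedDeriv_normalisedSum_eq_classes {ι κ : Type*} [Fintype ι] [Fintype κ] [DecidableEq κ]
    (cls : ι → κ) (a ε : ι → ℝ) (wc : κ → ℝ) (μ : ℝ) (j : ℕ) (s : ℝ) :
    iteratedDeriv j (fun s => (∑ i, a i * Real.exp ((wc (cls i) + ε i) * s)) / μ) s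
      = ∑ k, Real.exp (wc k * s) * ∑ r ∈ Finset.range (j + 1), (j.choose r : ℝ) * wc k ^ (j - r) *
          ((∑ i, (if cls i = k then a i else 0) * ε i ^ r * Real.exp (ε i * s)) / μ) := by
  -- the normalised sum is an `expSum` with coefficients `a_i/μ`
  have hfun : (fun s => (∑ i, a i * Real.exp ((wc (cls i) + ε i) * s)) / μ)
      = Bubbling.expSum (fun i => a i / μ) (fun i => wc (cls i) + ε i) := by
    funext s
    simp only [Bubbling.expSum, Finset.sum_div]
    refine Finset.sum_congr rfl fun i _ => ?_
    ring
  rw [hfun, iteratedDeriv_expSum]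
  simp only [Bubbling.expSum]
  rw [sum_eq_sum_classes cls]
  refine Finset.sum_congr rfl fun k _ => ?_
  -- inside class `k` every exponent is `wc k + ε i`
  have hk : ∀ i, (if cls i = k then a i / μ * (wc (cls i) + ε i) ^ j * Real.exp ((wc (cls i) + ε i) * s) else 0)
      = (if cls i = k then a i / μ else 0) * (wc k + ε i) ^ j * Real.exp ((wc k + ε i) * s) := by
    intro i
    by_cases h : cls i = k
    · rw [if_pos h, if_pos h, h]
    · rw [if_neg h, if_neg h, zero_mul, zero_mul]
  simp only [hk]
  rw [expSum_classWeights]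
  congr 1
  refine Finset.sum_congr rfl fun r _ => ?_
  congr 1
  rw [Finset.sum_div]
  refine Finset.sum_congr rfl fun i _ => ?_
  by_cases h : cls i = k
  · rw [if_pos h, if_pos h]; ring
  · rw [if_neg h, if_neg h]; ring

/-! ## 3. The limit identity -/

/-- **LIMIT IDENTITY.**  The `j`-th derivative of `g(s) = Σ_k Q_{k,0}(s)·e^{w_k s}` by Leibniz and the Taylor tower. [folklore] -/
theorem iteratedDeriv_classLimitFun {κ : Type*} [Fintype κ] (w : κ → ℝ) (n : κ → ℕ) (c : κ → ℕ → ℝ) (j : ℕ) (s : ℝ) :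
    iteratedDeriv j (fun s => ∑ k, (∑ m ∈ Finset.range (n k), c k m * s ^ m / (m.factorial : ℝ)) * Real.exp (w k * s)) s
      = ∑ k, Real.exp (w k * s) * ∑ r ∈ Finset.range (j + 1), (j.choose r : ℝ) * w k ^ (j - r) *
          (∑ m ∈ Finset.range (n k - r), c k (r + m) * s ^ m / (m.factorial : ℝ)) := by
  -- rewrite the class polynomial as the ground floor of its tower
  have hQ0 : ∀ k, (fun s : ℝ => ∑ m ∈ Finset.range (n k), c k m * s ^ m / (m.factorial : ℝ))
      = fun s => ∑ m ∈ Finset.range (n k - 0), c k (0 + m) * s ^ m / (m.factorial : ℝ) := by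
    intro k; funext s; simp only [Nat.sub_zero, zero_add]
  have hcd : ∀ k (N : ℕ), ContDiff ℝ N (fun s : ℝ => ∑ m ∈ Finset.range (n k - 0), c k (0 + m) * s ^ m / (m.factorial : ℝ)) :=
    fun k N => contDiff_taylorPoly (c k) (n k) 0 N
  have hce : ∀ k (N : ℕ), ContDiff ℝ N (fun s : ℝ => Real.exp (w k * s)) :=
    fun k N => Real.contDiff_exp.comp (contDiff_const.mul contDiff_id)
  have hterm : ∀ k, (fun s : ℝ => (∑ m ∈ Finset.range (n k), c k m * s ^ m / (m.factorial : ℝ)) * Real.exp (w k * s))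
      = (fun s : ℝ => ∑ m ∈ Finset.range (n k - 0), c k (0 + m) * s ^ m / (m.factorial : ℝ)) * (fun s => Real.exp (w k * s)) := by
    intro k; funext s; simp only [Pi.mul_apply, Nat.sub_zero, zero_add]
  rw [iteratedDeriv_fun_sum (fun k _ => by rw [hterm]; exact ((hcd k j).mul (hce k j)).contDiffAt)]
  refine Finset.sum_congr rfl fun k _ => ?_
  rw [hterm, iteratedDeriv_mul (hcd k j).contDiffAt (hce k j).contDiffAt, Finset.mul_sum]
  refine Finset.sum_congr rfl fun r _ => ?_
  rw [iteratedDeriv_taylorPoly, iteratedDeriv_exp_const_mul]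
  ring

/-! ## 4. The class assembly -/

/-- **THE CLASS ASSEMBLY.**  See the module docstring. [this work] -/
theorem classLimit_iteratedDeriv {ι κ : Type*} [Fintype ι] [Fintype κ] [DecidableEq κ]
    (cls : ι → κ) (a ε : ℕ → ι → ℝ) (wν : ℕ → κ → ℝ) (w : κ → ℝ) (μ : ℕ → ℝ) (n : κ → ℕ) (c : κ → ℕ → ℝ)
    (hw : ∀ k, Tendsto (fun ν => wν ν k) atTop (𝓝 (w k)))
    (hclass : ∀ (k : κ) (r : ℕ) (φ : ℕ → ℕ), StrictMono φ → ∀ (R : ℝ) (t : ℕ → ℝ) (t₀ : ℝ), (∀ l, |t l| ≤ R) →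
      Tendsto t atTop (𝓝 t₀) →
      Tendsto (fun l => (∑ i, (if cls i = k then a (φ l) i else 0) * ε (φ l) i ^ r * Real.exp (ε (φ l) i * t l)) / μ (φ l))
        atTop (𝓝 (∑ m ∈ Finset.range (n k - r), c k (r + m) * t₀ ^ m / (m.factorial : ℝ))))
    (j : ℕ) (φ : ℕ → ℕ) (hφ : StrictMono φ) (R : ℝ) (t : ℕ → ℝ) (t₀ : ℝ) (htR : ∀ l, |t l| ≤ R)
    (htlim : Tendsto t atTop (𝓝 t₀)) :
    Tendsto (fun l => iteratedDeriv j
        (fun s => (∑ i, a (φ l) i * Real.exp ((wν (φ l) (cls i) + ε (φ l) i) * s)) / μ (φ l)) (t l)) atTop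
      (𝓝 (iteratedDeriv j (fun s => ∑ k, (∑ m ∈ Finset.range (n k), c k m * s ^ m / (m.factorial : ℝ)) * Real.exp (w k * s)) t₀)) := by
  simp only [iteratedDeriv_normalisedSum_eq_classes]
  rw [iteratedDeriv_classLimitFun]
  have hwφ : ∀ k, Tendsto (fun l => wν (φ l) k) atTop (𝓝 (w k)) := fun k => (hw k).comp hφ.tendsto_atTop
  refine tendsto_finsetSum _ fun k _ => ?_
  refine ((Real.continuous_exp.tendsto _).comp ((hwφ k).mul htlim)).mul ?_
  refine tendsto_finsetSum _ fun r _ => ?_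
  exact ((tendsto_const_nhds.mul ((hwφ k).pow (j - r))).mul (hclass k r φ hφ R t t₀ htR htlim))

end Summit.ValiantsHypothesis.ValiantsHypothesis.Theorems.LacunarySymmetroidMatrixDescartes.WallBubbling
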